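import Summits.AtomisticToContinuum.Crystallization.Theorems.HullExactificationCascadeZeroDefectDensityLocalStructureQuad
import Mathlib.Data.Set.Card
import HarnessLib

/-!
# Local structure of a soft twelve-shell — part 5/6: the rotation at one vertex
# (route `HullExactificationCascade`, crux `ZeroDefectDensity`, stmt-AtomisticToContinuum-12086;
# line `birth`, stub `stub_localStructure`)

Support file (lead c5, stub-worker K3), continuing `…LocalStructureQuad` (frame functions
`R, P, D, S`, `hF`, `orient3` as in `…LocalStructureFrame`).  At a shell point `v` with the census
(four contacts, exactly two contact pairs among them: the hypotheses `hN`, `hQ` of the stub at `v`)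
pick a contact pair `{c₀, c₁}` of contacts, oriented so that `T(c₀, c₁) > 0` (`rot_asmTne`,
`T = orient3` in the frame at `v`); let `{d, e}` be the other two contacts (`Set.ncard`
bookkeeping).  The second contact pair is `{c₁, d}`, `{c₁, e}`, `{c₀, d}`, `{c₀, e}`
or `{d, e}` (and there is no third); the wedge orients it, and `rot_asmSS` / `rot_asmSL` give the
cyclic labelling `k₀ → k₁ → k₂ → k₃ → k₀` of the four contacts with `k₀k₁` in contact, `k₃k₀` not,
`k₁k₂` in contact iff `k₂k₃` is not, all four corners positively oriented, the large ones with
`D ∈ [-0.40, -0.30]`, the diagonals with `|·|² ≥ 2.6` (`rot_vertex_core`, `rot_vertex`).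

Mathlib + parts 1–4 only; no named fact is used. [folklore]
-/

noncomputable section

namespace Summit.AtomisticToContinuum.Crystallization.Theorems.ZeroDefectDensityBirth

open scoped RealInnerProductSpace
open Literature.Geometry.DiscreteGeometry

/-! ## Small combinatorial helpers -/

/-- A pair `{a, b}` differs from `{a', b'}` if `a` is neither `a'` nor `b'`. [folklore] -/
theorem rot_pair_ne {α : Type*} {a b a' b' : α} (h1 : a ≠ a') (h2 : a ≠ b') :
    ({a, b} : Set α) ≠ {a', b'} := by
  intro h
  have : a ∈ ({a', b'} : Set α) := h ▸ Set.mem_insert a {b}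
  rcases this with h' | h'
  · exact h1 h'
  · exact h2 h'

/-- Pigeonhole: three pairwise distinct objects cannot all lie in a two-element list. [folklore] -/
theorem rot_noThird {α : Type*} {A B C P Q : α} (hA : A = P ∨ A = Q) (hB : B = P ∨ B = Q)
    (hC : C = P ∨ C = Q) (hAB : A ≠ B) (hAC : A ≠ C) (hBC : B ≠ C) : False := by
  rcases hA with rfl | rfl <;> rcases hB with rfl | rfl <;> rcases hC with h | h <;>
    first | exact hAB rfl | exact hAC h.symm | exact hBC h.symm

/-! ## The rotation at one vertex -/

variable {R : EuclideanSpace ℝ (Fin 3) → EuclideanSpace ℝ (Fin 3) → ℝ}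
  {P D S : EuclideanSpace ℝ (Fin 3) → EuclideanSpace ℝ (Fin 3) → EuclideanSpace ℝ (Fin 3) → ℝ}
  (hF : (∀ c x, R c x = ‖c‖ ^ 2 * ‖x‖ ^ 2 - ⟪c, x⟫ ^ 2) ∧
    (∀ c x y, P c x y = ‖c‖ ^ 2 * ⟪x, y⟫ - ⟪c, x⟫ * ⟪c, y⟫) ∧
    (∀ c x y, D c x y = P c x y / (√(R c x) * √(R c y))) ∧
    (∀ c x y, S c x y = ‖c‖ * orient3 c x y / (√(R c x) * √(R c y))))
include hF

/-- **One vertex, oriented first edge given.**  `c₀, c₁` a contact pair of contacts of `v` with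
`T(c₀, c₁) > 0`; the census digested as: every contact pair of contacts of `v` is `{c₀, c₁}` or
the fixed second pair `E`, and some contact pair is not `{c₀, c₁}`.  Then the four contacts of `v`
admit a cyclic labelling `k₀, k₁, k₂, k₃` with `k₀k₁` in contact, `k₃k₀` not, `k₁k₂` in contact iff
`k₂k₃` is not, all corners positively oriented, large corners with `D ∈ [-0.40, -0.30]`, diagonals
`|·|² ≥ 2.6`. [folklore] -/
theorem rot_vertex_core (u : EuclideanSpace ℝ (Fin 3)) (p : Fin 12 → EuclideanSpace ℝ (Fin 3))
    (H1 : ∀ i : Fin 12, 1 - 1 / 4000 ≤ dist u (p i) ∧ dist u (p i) ≤ 1 + 1 / 4000)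
    (H2 : ∀ i j : Fin 12, i ≠ j → 1 - 1 / 4000 ≤ dist (p i) (p j) ∧
      (dist (p i) (p j) ≤ 1 + 1 / 4000 ∨ 7 / 5 ≤ dist (p i) (p j)))
    (v c0 c1 : Fin 12) (E : Set (Fin 12))
    (hN : {j : Fin 12 | j ≠ v ∧ dist (p v) (p j) ≤ 1 + 1 / 4000}.ncard = 4)
    (cen : ∀ a b : Fin 12, a ≠ v → b ≠ v → dist (p v) (p a) ≤ 1 + 1 / 4000 →
      dist (p v) (p b) ≤ 1 + 1 / 4000 → a ≠ b → dist (p a) (p b) ≤ 1 + 1 / 4000 →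
      ({a, b} : Set (Fin 12)) = {c0, c1} ∨ ({a, b} : Set (Fin 12)) = E)
    (sec : ∃ a b : Fin 12, a ≠ v ∧ b ≠ v ∧ dist (p v) (p a) ≤ 1 + 1 / 4000 ∧
      dist (p v) (p b) ≤ 1 + 1 / 4000 ∧ a ≠ b ∧ dist (p a) (p b) ≤ 1 + 1 / 4000 ∧
      ({a, b} : Set (Fin 12)) ≠ {c0, c1})
    (hc0 : c0 ≠ v ∧ dist (p v) (p c0) ≤ 1 + 1 / 4000)
    (hc1 : c1 ≠ v ∧ dist (p v) (p c1) ≤ 1 + 1 / 4000)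
    (h01 : c0 ≠ c1) (hct : dist (p c0) (p c1) ≤ 1 + 1 / 4000)
    (t01 : 0 < orient3 (u - p v) (p c0 - p v) (p c1 - p v)) :
    ∃ k0 k1 k2 k3 : Fin 12,
      (k0 ≠ k1 ∧ k0 ≠ k2 ∧ k0 ≠ k3 ∧ k1 ≠ k2 ∧ k1 ≠ k3 ∧ k2 ≠ k3) ∧
      ((k0 ≠ v ∧ dist (p v) (p k0) ≤ 1 + 1 / 4000) ∧ (k1 ≠ v ∧ dist (p v) (p k1) ≤ 1 + 1 / 4000) ∧
        (k2 ≠ v ∧ dist (p v) (p k2) ≤ 1 + 1 / 4000) ∧ (k3 ≠ v ∧ dist (p v) (p k3) ≤ 1 + 1 / 4000)) ∧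
      (∀ a : Fin 12, a ≠ v → dist (p v) (p a) ≤ 1 + 1 / 4000 → a = k0 ∨ a = k1 ∨ a = k2 ∨ a = k3) ∧
      (dist (p k0) (p k1) ≤ 1 + 1 / 4000 ∧ ¬dist (p k3) (p k0) ≤ 1 + 1 / 4000 ∧
        (dist (p k1) (p k2) ≤ 1 + 1 / 4000 ↔ ¬dist (p k2) (p k3) ≤ 1 + 1 / 4000)) ∧
      (0 < orient3 (u - p v) (p k0 - p v) (p k1 - p v) ∧
      0 < orient3 (u - p v) (p k1 - p v) (p k2 - p v) ∧
      0 < orient3 (u - p v) (p k2 - p v) (p k3 - p v) ∧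
      0 < orient3 (u - p v) (p k3 - p v) (p k0 - p v) ∧
      (¬dist (p k1) (p k2) ≤ 1 + 1 / 4000 →
        -0.40 ≤ D (u - p v) (p k1 - p v) (p k2 - p v) ∧
          D (u - p v) (p k1 - p v) (p k2 - p v) ≤ -0.30) ∧
      (¬dist (p k2) (p k3) ≤ 1 + 1 / 4000 →
        -0.40 ≤ D (u - p v) (p k2 - p v) (p k3 - p v) ∧
          D (u - p v) (p k2 - p v) (p k3 - p v) ≤ -0.30) ∧
      (¬dist (p k3) (p k0) ≤ 1 + 1 / 4000 →
        -0.40 ≤ D (u - p v) (p k3 - p v) (p k0 - p v) ∧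
          D (u - p v) (p k3 - p v) (p k0 - p v) ≤ -0.30) ∧
      2.6 ≤ dist (p k0) (p k2) ^ 2 ∧ 2.6 ≤ dist (p k1) (p k3) ^ 2) := by
  -- the other two contacts `d, e`
  set N : Set (Fin 12) := {j : Fin 12 | j ≠ v ∧ dist (p v) (p j) ≤ 1 + 1 / 4000} with hNdef
  have hsub : ({c0, c1} : Set (Fin 12)) ⊆ N := by
    rintro j (rfl | rfl)
    · exact hc0
    · exact hc1
  have hdiff : (N \ {c0, c1}).ncard = 2 := by
    rw [Set.ncard_sdiff hsub, hN, Set.ncard_pair h01]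
  obtain ⟨d, e, hde, hNe⟩ := Set.ncard_eq_two.mp hdiff
  have hd : d ∈ N \ {c0, c1} := hNe ▸ Set.mem_insert d {e}
  have he : e ∈ N \ {c0, c1} := hNe ▸ Set.mem_insert_of_mem d (Set.mem_singleton e)
  simp only [Set.mem_sdiff, Set.mem_insert_iff, Set.mem_singleton_iff, not_or] at hd he
  obtain ⟨hdN, hd0, hd1⟩ := hd
  obtain ⟨heN, he0, he1⟩ := he
  have cover : ∀ a : Fin 12, a ≠ v → dist (p v) (p a) ≤ 1 + 1 / 4000 →
      a = c0 ∨ a = c1 ∨ a = d ∨ a = e := by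
    intro a hav hca
    by_cases h0 : a = c0
    · exact Or.inl h0
    by_cases h1 : a = c1
    · exact Or.inr (Or.inl h1)
    have : a ∈ N \ {c0, c1} := by
      simp only [Set.mem_sdiff, Set.mem_insert_iff, Set.mem_singleton_iff, not_or]
      exact ⟨⟨hav, hca⟩, h0, h1⟩
    rw [hNe] at this
    rcases this with h | h
    · exact Or.inr (Or.inr (Or.inl h))
    · exact Or.inr (Or.inr (Or.inr h))
  -- symmetric contact facts
  have sym : ∀ i j : Fin 12, dist (p i) (p j) ≤ 1 + 1 / 4000 → dist (p j) (p i) ≤ 1 + 1 / 4000 :=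
    fun i j h => by rwa [dist_comm]
  -- no third contact pair
  have third : ∀ a b : Fin 12, a ≠ v → b ≠ v → dist (p v) (p a) ≤ 1 + 1 / 4000 →
      dist (p v) (p b) ≤ 1 + 1 / 4000 → a ≠ b → dist (p a) (p b) ≤ 1 + 1 / 4000 →
      ∀ a' b' : Fin 12, a' ≠ v → b' ≠ v → dist (p v) (p a') ≤ 1 + 1 / 4000 →
      dist (p v) (p b') ≤ 1 + 1 / 4000 → a' ≠ b' → dist (p a') (p b') ≤ 1 + 1 / 4000 →
      ({a, b} : Set (Fin 12)) ≠ {c0, c1} → ({a', b'} : Set (Fin 12)) ≠ {c0, c1} →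
      ({a, b} : Set (Fin 12)) ≠ {a', b'} → False := by
    intro a b ha hb hca hcb hab hcab a' b' ha' hb' hca' hcb' hab' hcab' h1 h2 h3
    exact rot_noThird (Or.inl rfl) (cen a b ha hb hca hcb hab hcab)
      (cen a' b' ha' hb' hca' hcb' hab' hcab') h1.symm h2.symm h3
  have posR : ∀ {a b : ℝ}, 0 < a → 0 < a * b → 0 < b := fun ha h => pos_of_mul_pos_right h ha.le
  -- pair bookkeeping: the five candidate second pairs differ from `{c0, c1}`
  have Pc1d : ({c1, d} : Set (Fin 12)) ≠ {c0, c1} := by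
    rw [Set.pair_comm c1 d]; exact rot_pair_ne hd0 hd1
  have Pc1e : ({c1, e} : Set (Fin 12)) ≠ {c0, c1} := by
    rw [Set.pair_comm c1 e]; exact rot_pair_ne he0 he1
  have Pc0d : ({c0, d} : Set (Fin 12)) ≠ {c0, c1} := by
    rw [Set.pair_comm c0 d]; exact rot_pair_ne hd0 hd1
  have Pc0e : ({c0, e} : Set (Fin 12)) ≠ {c0, c1} := by
    rw [Set.pair_comm c0 e]; exact rot_pair_ne he0 he1
  have Pde : ({d, e} : Set (Fin 12)) ≠ {c0, c1} := rot_pair_ne hd0 hd1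
  have nc1d : c1 ≠ d := fun h => hd1 h.symm
  have nc1e : c1 ≠ e := fun h => he1 h.symm
  have nc0d : c0 ≠ d := fun h => hd0 h.symm
  have nc0e : c0 ≠ e := fun h => he0 h.symm
  -- `third'`: a contact pair `{a, b} ≠ {c0, c1}` excludes any other contact pair
  -- `{a', b'} ≠ {c0, c1}`
  have third' : ∀ a b : Fin 12, a ≠ v ∧ dist (p v) (p a) ≤ 1 + 1 / 4000 →
      b ≠ v ∧ dist (p v) (p b) ≤ 1 + 1 / 4000 → a ≠ b → dist (p a) (p b) ≤ 1 + 1 / 4000 →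
      ({a, b} : Set (Fin 12)) ≠ {c0, c1} →
      ∀ a' b' : Fin 12, a' ≠ v ∧ dist (p v) (p a') ≤ 1 + 1 / 4000 →
      b' ≠ v ∧ dist (p v) (p b') ≤ 1 + 1 / 4000 → a' ≠ b' →
      ({a', b'} : Set (Fin 12)) ≠ {c0, c1} → ({a, b} : Set (Fin 12)) ≠ {a', b'} →
      ¬dist (p a') (p b') ≤ 1 + 1 / 4000 :=
    fun a b ha hb hab hcab hne a' b' ha' hb' hab' hne' hne'' hcab' =>
      third a b ha.1 hb.1 ha.2 hb.2 hab hcab a' b' ha'.1 hb'.1 ha'.2 hb'.2 hab' hcab' hne hne' hne''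
  by_cases h1 : dist (p c1) (p d) ≤ 1 + 1 / 4000
  · -- shape SS on (c0, c1, d, e)
    have fde : ¬dist (p d) (p e) ≤ 1 + 1 / 4000 :=
      third' c1 d hc1 hdN nc1d h1 Pc1d d e hdN heN hde Pde (rot_pair_ne nc1d nc1e)
    have fec0 : ¬dist (p e) (p c0) ≤ 1 + 1 / 4000 :=
      third' c1 d hc1 hdN nc1d h1 Pc1d e c0 heN hc0 he0 (by rw [Set.pair_comm e c0]; exact Pc0e)
        (rot_pair_ne nc1e h01.symm)
    have hw := rot_asmWedge hF u p H1 H2 v c0 c1 d hc0 hc1 hdN h01.symm nc1d nc0d (sym _ _ hct) h1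
    rw [orient3_swap_right (u - p v) (p c1 - p v) (p c0 - p v)] at hw
    have t12 : 0 < orient3 (u - p v) (p c1 - p v) (p d - p v) := posR t01 (by linarith)
    refine ⟨c0, c1, d, e, ⟨h01, nc0d, nc0e, nc1d, nc1e, hde⟩, ⟨hc0, hc1, hdN, heN⟩, cover,
      ⟨hct, fec0, ⟨fun _ => fde, fun _ => h1⟩⟩, ?_⟩
    exact rot_asmSS hF u p H1 H2 v c0 c1 d e hc0 hc1 hdN heN h01 nc0e nc1d hde hct h1 fde fec0 t01
      t12
  by_cases h2 : dist (p c1) (p e) ≤ 1 + 1 / 4000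
  · -- shape SS on (c0, c1, e, d)
    have fed : ¬dist (p e) (p d) ≤ 1 + 1 / 4000 :=
      third' c1 e hc1 heN nc1e h2 Pc1e e d heN hdN hde.symm (by rw [Set.pair_comm e d]; exact Pde)
        (rot_pair_ne nc1e nc1d)
    have fdc0 : ¬dist (p d) (p c0) ≤ 1 + 1 / 4000 :=
      third' c1 e hc1 heN nc1e h2 Pc1e d c0 hdN hc0 hd0 (by rw [Set.pair_comm d c0]; exact Pc0d)
        (rot_pair_ne nc1d h01.symm)
    have hw := rot_asmWedge hF u p H1 H2 v c0 c1 e hc0 hc1 heN h01.symm nc1e nc0e (sym _ _ hct) h2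
    rw [orient3_swap_right (u - p v) (p c1 - p v) (p c0 - p v)] at hw
    have t12 : 0 < orient3 (u - p v) (p c1 - p v) (p e - p v) := posR t01 (by linarith)
    refine ⟨c0, c1, e, d, ⟨h01, nc0e, nc0d, nc1e, nc1d, hde.symm⟩, ⟨hc0, hc1, heN, hdN⟩, ?_,
      ⟨hct, fdc0, ⟨fun _ => fed, fun _ => h2⟩⟩, ?_⟩
    · intro a ha hca
      rcases cover a ha hca with h | h | h | h
      exacts [Or.inl h, Or.inr (Or.inl h), Or.inr (Or.inr (Or.inr h)), Or.inr (Or.inr (Or.inl h))]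
    · exact rot_asmSS hF u p H1 H2 v c0 c1 e d hc0 hc1 heN hdN h01 nc0d nc1e hde.symm hct h2 fed
        fdc0 t01 t12
  by_cases h3 : dist (p c0) (p d) ≤ 1 + 1 / 4000
  · -- shape SS on (d, c0, c1, e)
    have fed : ¬dist (p e) (p d) ≤ 1 + 1 / 4000 :=
      third' c0 d hc0 hdN nc0d h3 Pc0d e d heN hdN hde.symm (by rw [Set.pair_comm e d]; exact Pde)
        (rot_pair_ne nc0e nc0d)
    have hw := rot_asmWedge hF u p H1 H2 v c1 c0 d hc1 hc0 hdN h01 nc0d nc1d hct h3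
    rw [orient3_swap_right (u - p v) (p c0 - p v) (p d - p v)] at hw
    have t0 : 0 < orient3 (u - p v) (p d - p v) (p c0 - p v) := posR t01 (by linarith)
    refine ⟨d, c0, c1, e, ⟨hd0, hd1, hde, h01, nc0e, nc1e⟩, ⟨hdN, hc0, hc1, heN⟩, ?_,
      ⟨sym _ _ h3, fed, ⟨fun _ => h2, fun _ => hct⟩⟩, ?_⟩
    · intro a ha hca
      rcases cover a ha hca with h | h | h | h
      exacts [Or.inr (Or.inl h), Or.inr (Or.inr (Or.inl h)), Or.inl h, Or.inr (Or.inr (Or.inr h))]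
    · exact rot_asmSS hF u p H1 H2 v d c0 c1 e hdN hc0 hc1 heN hd0 hde h01 nc1e (sym _ _ h3) hct h2
        fed t0 t01
  by_cases h4 : dist (p c0) (p e) ≤ 1 + 1 / 4000
  · -- shape SS on (e, c0, c1, d)
    have fde : ¬dist (p d) (p e) ≤ 1 + 1 / 4000 :=
      third' c0 e hc0 heN nc0e h4 Pc0e d e hdN heN hde Pde (rot_pair_ne nc0d nc0e)
    have hw := rot_asmWedge hF u p H1 H2 v c1 c0 e hc1 hc0 heN h01 nc0e nc1e hct h4
    rw [orient3_swap_right (u - p v) (p c0 - p v) (p e - p v)] at hw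
    have t0 : 0 < orient3 (u - p v) (p e - p v) (p c0 - p v) := posR t01 (by linarith)
    refine ⟨e, c0, c1, d, ⟨he0, he1, hde.symm, h01, nc0d, nc1d⟩, ⟨heN, hc0, hc1, hdN⟩, ?_,
      ⟨sym _ _ h4, fde, ⟨fun _ => h1, fun _ => hct⟩⟩, ?_⟩
    · intro a ha hca
      rcases cover a ha hca with h | h | h | h
      exacts [Or.inr (Or.inl h), Or.inr (Or.inr (Or.inl h)), Or.inr (Or.inr (Or.inr h)), Or.inl h]
    · exact rot_asmSS hF u p H1 H2 v e c0 c1 d heN hc0 hc1 hdN he0 hde.symm h01 nc1d (sym _ _ h4)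
        hct h1 fde t0 t01
  by_cases h5 : dist (p d) (p e) ≤ 1 + 1 / 4000
  · -- shape SL on (c0, c1, d, e) or (c0, c1, e, d)
    have fec0 : ¬dist (p e) (p c0) ≤ 1 + 1 / 4000 := fun h => h4 (sym _ _ h)
    have fdc0 : ¬dist (p d) (p c0) ≤ 1 + 1 / 4000 := fun h => h3 (sym _ _ h)
    rcases (rot_asmTne hF u p H1 H2 v d e hdN heN hde h5).lt_or_gt with hneg | hpos
    · have t23 : 0 < orient3 (u - p v) (p e - p v) (p d - p v) := by
        rw [orient3_swap_right (u - p v) (p e - p v) (p d - p v)]; linarith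
      refine ⟨c0, c1, e, d, ⟨h01, nc0e, nc0d, nc1e, nc1d, hde.symm⟩, ⟨hc0, hc1, heN, hdN⟩, ?_,
        ⟨hct, fdc0, ⟨fun h => absurd h h2, fun h => absurd (sym _ _ h5) h⟩⟩, ?_⟩
      · intro a ha hca
        rcases cover a ha hca with h | h | h | h
        exacts [Or.inl h, Or.inr (Or.inl h), Or.inr (Or.inr (Or.inr h)), Or.inr (Or.inr (Or.inl h))]
      · exact rot_asmSL hF u p H1 H2 v c0 c1 e d hc0 hc1 heN hdN h01 nc0d nc1e hde.symm hct
          (sym _ _ h5) h2 fdc0 t01 t23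
    · refine ⟨c0, c1, d, e, ⟨h01, nc0d, nc0e, nc1d, nc1e, hde⟩, ⟨hc0, hc1, hdN, heN⟩, cover,
        ⟨hct, fec0, ⟨fun h => absurd h h1, fun h => absurd h5 h⟩⟩, ?_⟩
      exact rot_asmSL hF u p H1 H2 v c0 c1 d e hc0 hc1 hdN heN h01 nc0e nc1d hde hct h5 h1 fec0 t01
        hpos
  -- no second pair: contradiction with the census
  exfalso
  obtain ⟨a, b, ha, hb, hca, hcb, hab, hcab, hne⟩ := sec
  rcases cover a ha hca with rfl | rfl | rfl | rfl <;>
    rcases cover b hb hcb with rfl | rfl | rfl | rfl <;>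
    first
    | exact hab rfl
    | exact hne rfl
    | exact hne (Set.pair_comm _ _)
    | exact h1 hcab
    | exact h1 (sym _ _ hcab)
    | exact h2 hcab
    | exact h2 (sym _ _ hcab)
    | exact h3 hcab
    | exact h3 (sym _ _ hcab)
    | exact h4 hcab
    | exact h4 (sym _ _ hcab)
    | exact h5 hcab
    | exact h5 (sym _ _ hcab)

/-- **One vertex.**  Under the census at `v` (four contacts, exactly two contact pairs among
them) the four contacts of `v` admit the cyclic labelling of `rot_vertex_core`. [folklore] -/
theorem rot_vertex (u : EuclideanSpace ℝ (Fin 3)) (p : Fin 12 → EuclideanSpace ℝ (Fin 3))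
    (H1 : ∀ i : Fin 12, 1 - 1 / 4000 ≤ dist u (p i) ∧ dist u (p i) ≤ 1 + 1 / 4000)
    (H2 : ∀ i j : Fin 12, i ≠ j → 1 - 1 / 4000 ≤ dist (p i) (p j) ∧
      (dist (p i) (p j) ≤ 1 + 1 / 4000 ∨ 7 / 5 ≤ dist (p i) (p j)))
    (v : Fin 12) (hN : {j : Fin 12 | j ≠ v ∧ dist (p v) (p j) ≤ 1 + 1 / 4000}.ncard = 4)
    (hQ : {q : Fin 12 × Fin 12 | q.1 < q.2 ∧ q.1 ≠ v ∧ q.2 ≠ v ∧ dist (p v) (p q.1) ≤ 1 + 1 / 4000 ∧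
      dist (p v) (p q.2) ≤ 1 + 1 / 4000 ∧ dist (p q.1) (p q.2) ≤ 1 + 1 / 4000}.ncard = 2) :
    ∃ k0 k1 k2 k3 : Fin 12,
      (k0 ≠ k1 ∧ k0 ≠ k2 ∧ k0 ≠ k3 ∧ k1 ≠ k2 ∧ k1 ≠ k3 ∧ k2 ≠ k3) ∧
      ((k0 ≠ v ∧ dist (p v) (p k0) ≤ 1 + 1 / 4000) ∧ (k1 ≠ v ∧ dist (p v) (p k1) ≤ 1 + 1 / 4000) ∧
        (k2 ≠ v ∧ dist (p v) (p k2) ≤ 1 + 1 / 4000) ∧ (k3 ≠ v ∧ dist (p v) (p k3) ≤ 1 + 1 / 4000)) ∧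
      (∀ a : Fin 12, a ≠ v → dist (p v) (p a) ≤ 1 + 1 / 4000 → a = k0 ∨ a = k1 ∨ a = k2 ∨ a = k3) ∧
      (dist (p k0) (p k1) ≤ 1 + 1 / 4000 ∧ ¬dist (p k3) (p k0) ≤ 1 + 1 / 4000 ∧
        (dist (p k1) (p k2) ≤ 1 + 1 / 4000 ↔ ¬dist (p k2) (p k3) ≤ 1 + 1 / 4000)) ∧
      (0 < orient3 (u - p v) (p k0 - p v) (p k1 - p v) ∧
      0 < orient3 (u - p v) (p k1 - p v) (p k2 - p v) ∧
      0 < orient3 (u - p v) (p k2 - p v) (p k3 - p v) ∧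
      0 < orient3 (u - p v) (p k3 - p v) (p k0 - p v) ∧
      (¬dist (p k1) (p k2) ≤ 1 + 1 / 4000 →
        -0.40 ≤ D (u - p v) (p k1 - p v) (p k2 - p v) ∧
          D (u - p v) (p k1 - p v) (p k2 - p v) ≤ -0.30) ∧
      (¬dist (p k2) (p k3) ≤ 1 + 1 / 4000 →
        -0.40 ≤ D (u - p v) (p k2 - p v) (p k3 - p v) ∧
          D (u - p v) (p k2 - p v) (p k3 - p v) ≤ -0.30) ∧
      (¬dist (p k3) (p k0) ≤ 1 + 1 / 4000 →
        -0.40 ≤ D (u - p v) (p k3 - p v) (p k0 - p v) ∧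
          D (u - p v) (p k3 - p v) (p k0 - p v) ≤ -0.30) ∧
      2.6 ≤ dist (p k0) (p k2) ^ 2 ∧ 2.6 ≤ dist (p k1) (p k3) ^ 2) := by
  have sym : ∀ i j : Fin 12, dist (p i) (p j) ≤ 1 + 1 / 4000 → dist (p j) (p i) ≤ 1 + 1 / 4000 :=
    fun i j h => by rwa [dist_comm]
  obtain ⟨q, q', hqq, hQe⟩ := Set.ncard_eq_two.mp hQ
  have hq : q ∈ ({q, q'} : Set (Fin 12 × Fin 12)) := Set.mem_insert _ _
  have hq' : q' ∈ ({q, q'} : Set (Fin 12 × Fin 12)) := Set.mem_insert_of_mem _ rfl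
  rw [← hQe] at hq hq'
  obtain ⟨hlt, h1v, h2v, hc1, hc2, hc12⟩ := hq
  obtain ⟨hlt', h1v', h2v', hc1', hc2', hc12'⟩ := hq'
  have hxm : q.1 ≠ q.2 := ne_of_lt hlt
  have hxm' : q'.1 ≠ q'.2 := ne_of_lt hlt'
  have cen : ∀ a b : Fin 12, a ≠ v → b ≠ v → dist (p v) (p a) ≤ 1 + 1 / 4000 →
      dist (p v) (p b) ≤ 1 + 1 / 4000 → a ≠ b → dist (p a) (p b) ≤ 1 + 1 / 4000 →
      ({a, b} : Set (Fin 12)) = {q.1, q.2} ∨ ({a, b} : Set (Fin 12)) = {q'.1, q'.2} := by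
    intro a b ha hb hca hcb hab hcab
    rcases lt_or_gt_of_ne hab with h | h
    · have hm : (a, b) ∈ {q : Fin 12 × Fin 12 | q.1 < q.2 ∧ q.1 ≠ v ∧ q.2 ≠ v ∧
          dist (p v) (p q.1) ≤ 1 + 1 / 4000 ∧ dist (p v) (p q.2) ≤ 1 + 1 / 4000 ∧
          dist (p q.1) (p q.2) ≤ 1 + 1 / 4000} := ⟨h, ha, hb, hca, hcb, hcab⟩
      rw [hQe] at hm
      rcases hm with hm | hm
      · exact Or.inl (by rw [← hm])
      · exact Or.inr (by rw [← hm])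
    · have hm : (b, a) ∈ {q : Fin 12 × Fin 12 | q.1 < q.2 ∧ q.1 ≠ v ∧ q.2 ≠ v ∧
          dist (p v) (p q.1) ≤ 1 + 1 / 4000 ∧ dist (p v) (p q.2) ≤ 1 + 1 / 4000 ∧
          dist (p q.1) (p q.2) ≤ 1 + 1 / 4000} := ⟨h, hb, ha, hcb, hca, sym _ _ hcab⟩
      rw [hQe] at hm
      rw [Set.pair_comm a b]
      rcases hm with hm | hm
      · exact Or.inl (by rw [← hm])
      · exact Or.inr (by rw [← hm])
  have hne : ({q'.1, q'.2} : Set (Fin 12)) ≠ {q.1, q.2} := by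
    intro h
    rw [Set.pair_eq_pair_iff] at h
    rcases h with ⟨e1, e2⟩ | ⟨e1, e2⟩
    · exact hqq (Prod.ext e1 e2).symm
    · rw [e1, e2] at hlt'
      exact lt_asymm hlt hlt'
  have sec : ∃ a b : Fin 12, a ≠ v ∧ b ≠ v ∧ dist (p v) (p a) ≤ 1 + 1 / 4000 ∧
      dist (p v) (p b) ≤ 1 + 1 / 4000 ∧ a ≠ b ∧ dist (p a) (p b) ≤ 1 + 1 / 4000 ∧
      ({a, b} : Set (Fin 12)) ≠ {q.1, q.2} :=
    ⟨q'.1, q'.2, h1v', h2v', hc1', hc2', hxm', hc12', hne⟩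
  rcases (rot_asmTne hF u p H1 H2 v q.1 q.2 ⟨h1v, hc1⟩ ⟨h2v, hc2⟩ hxm hc12).lt_or_gt with
    hneg | hpos
  · have t : 0 < orient3 (u - p v) (p q.2 - p v) (p q.1 - p v) := by
      rw [orient3_swap_right (u - p v) (p q.2 - p v) (p q.1 - p v)]; linarith
    refine rot_vertex_core hF u p H1 H2 v q.2 q.1 {q'.1, q'.2} hN ?_ ?_ ⟨h2v, hc2⟩ ⟨h1v, hc1⟩
      hxm.symm (sym _ _ hc12) t
    · intro a b ha hb hca hcb hab hcab
      rw [Set.pair_comm q.2 q.1]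
      exact cen a b ha hb hca hcb hab hcab
    · rw [Set.pair_comm q.2 q.1]
      exact sec
  · exact rot_vertex_core hF u p H1 H2 v q.1 q.2 {q'.1, q'.2} hN cen sec ⟨h1v, hc1⟩ ⟨h2v, hc2⟩ hxm
      hc12 hpos

omit hF in
/-- **One vertex, closed form** (registered sub-goal `rot_vertexCycle` of
`stub_localStructure`, one line): `rot_vertex` without the azimuth windows. [folklore] -/
theorem rot_vertexCycle : ∀ (u : EuclideanSpace ℝ (Fin 3)) (p : Fin 12 → EuclideanSpace ℝ (Fin 3)), (∀ i : Fin 12, 1 - 1 / 4000 ≤ dist u (p i) ∧ dist u (p i) ≤ 1 + 1 / 4000) → (∀ i j : Fin 12, i ≠ j → 1 - 1 / 4000 ≤ dist (p i) (p j) ∧ (dist (p i) (p j) ≤ 1 + 1 / 4000 ∨ 7 / 5 ≤ dist (p i) (p j))) → ∀ (v : Fin 12), {j : Fin 12 | j ≠ v ∧ dist (p v) (p j) ≤ 1 + 1 / 4000}.ncard = 4 → {q : Fin 12 × Fin 12 | q.1 < q.2 ∧ q.1 ≠ v ∧ q.2 ≠ v ∧ dist (p v) (p q.1) ≤ 1 +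 1 / 4000 ∧ dist (p v) (p q.2) ≤ 1 + 1 / 4000 ∧ dist (p q.1) (p q.2) ≤ 1 + 1 / 4000}.ncard = 2 → ∃ k0 k1 k2 k3 : Fin 12, (k0 ≠ k1 ∧ k0 ≠ k2 ∧ k0 ≠ k3 ∧ k1 ≠ k2 ∧ k1 ≠ k3 ∧ k2 ≠ k3) ∧ ((k0 ≠ v ∧ dist (p v) (p k0) ≤ 1 + 1 / 4000) ∧ (k1 ≠ v ∧ dist (p v) (p k1) ≤ 1 + 1 / 4000) ∧ (k2 ≠ v ∧ dist (p v) (p k2) ≤ 1 + 1 / 4000) ∧ (k3 ≠ v ∧ dist (p v) (p k3) ≤ 1 + 1 / 4000)) ∧ (∀ a : Fin 12, a ≠ v → dist (p v) (p a) ≤ 1 + 1 / 4000 → a = k0 ∨ a = k1 ∨ a = k2 ∨ a = k3) ∧ (dist (p k0) (p k1) ≤ 1 + 1 / 4000 ∧ ¬ dist (p k3) (p k0) ≤ 1 + 1 / 4000 ∧ (dist (p k1) (p k2) ≤ 1 + 1 / 4000 ↔ ¬ dist (p k2) (p k3) ≤ 1 + 1 / 4000)) ∧ (0 < Literature.Geometry.DiscreteGeometry.orient3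 (u - p v) (p k0 - p v) (p k1 - p v) ∧ 0 < Literature.Geometry.DiscreteGeometry.orient3 (u - p v) (p k1 - p v) (p k2 - p v) ∧ 0 < Literature.Geometry.DiscreteGeometry.orient3 (u - p v) (p k2 - p v) (p k3 - p v) ∧ 0 < Literature.Geometry.DiscreteGeometry.orient3 (u - p v) (p k3 - p v) (p k0 - p v)) ∧ 2.6 ≤ dist (p k0) (p k2) ^ 2 ∧ 2.6 ≤ dist (p k1) (p k3) ^ 2 := by
  intro u p H1 H2 v hN hQ
  obtain ⟨R, P, D, S, hF⟩ := rot_frame_exists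
  obtain ⟨k0, k1, k2, k3, h1, h2, h3, h4, t01, t12, t23, t30, -, -, -, d02, d13⟩ :=
    rot_vertex hF u p H1 H2 v hN hQ
  exact ⟨k0, k1, k2, k3, h1, h2, h3, h4, ⟨t01, t12, t23, t30⟩, d02, d13⟩

end Summit.AtomisticToContinuum.Crystallization.Theorems.ZeroDefectDensityBirth
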